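import Mathlib
import Summits.KontsevichZagierPeriods.Zeta5Search.Families.BasicTwoCover
import HarnessLib

/-!
# ζ(5) search — Families: the universal growth bound — `M_σ ≤ 2^{−(ℓ+1)} = 2^{−(n−2)}` for EVERY convergent seating

HONEST FRAMING: systematic search; no irrationality claim unless certified.  STRUCTURAL facts about the size of Brown's
basic cellular integrals `I_σ(N) = ∫_{S_n} f_σ^N ω_σ` [Brown2016, §1.5 (1.3)–(1.4)] (seat P2, Families layer); nothing
about the arithmetic of any zeta value.

`Families/BasicGrowthBounds.lean` proved `M_σ = sup f_σ ≤ 1/2` for every convergent seating and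
`Families/BasicGrowthTwoFactor.lean` proved `M_σ ≤ 2^{−(ℓ+1)}` UNDER THE HYPOTHESIS that the finite `σδ⁰`-edges admit
two gap-disjoint Hall matchings (checked by `decide` for the named configurations).  Here the hypothesis is removed:

* **`fSigma_le_half_pow`**, **`fSup_le_half_pow`** — for EVERY convergent bijective seating `σ` of `n = ℓ + 3 ≥ 4`
  points, **`f_σ ≤ 2^{−(ℓ+1)}` on the open simplex and `M_σ ≤ 2^{−(ℓ+1)} = 2^{−(n−2)}`**;
* **`integral_basic_le_half_pow_pow`** — hence **`I_σ(N) ≤ 2^{−(n−2)N} · I_σ(0)`** for all `N ∈ ℕ`: the linear forms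
  of every basic cellular family on `n` points decay at least at the rate `2^{−(n−2)}` per step (with
  `tendsto_integral_basic_root` of `Families/BasicGrowth.lean`: `lim I_σ(N)^{1/N} = M_σ ≤ 2^{−(n−2)}`).

PROOF.  For an edge `e` let `u(e)` be a largest gap of its span and `v(e)` a largest among the others (every span has
`≥ 2` gaps, `two_le_card_span`); then `len_e ≥ g_{u(e)} + g_{v(e)} ≥ 2√(g_{u(e)} g_{v(e)})`.  It remains to show
`∏_w g_w² ≤ ∏_e g_{u(e)} g_{v(e)}` (`prod_gapN_sq_le_prod_top_two`).  For a threshold `θ` with super-level gap set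
`Z = {w : g_w ≥ θ}`, the number of factors `≥ θ` on the right is `N₁(Z) + N₂(Z)` (`g_{u(e)} ≥ θ` iff the span meets
`Z`, `g_{v(e)} ≥ θ` iff it meets `Z` twice) and on the left it is `2|Z|`; the TWO-COVER COUNT `2|Z| ≤ N₁(Z) + N₂(Z)`
of `Families/BasicTwoCover.lean` is therefore exactly Hall's condition for matching the `2(ℓ+1)` factors on the left
injectively to factors at least as large on the right (`Finset.all_card_le_biUnion_card_iff_exists_injective`).
Standard axioms only.
-/

noncomputable section

open MeasureTheory Set Finset Filter Topology

namespace Summit.KontsevichZagierPeriods.Zeta5Search.Families.Cellular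

variable {ℓ : ℕ} (σ : Fin (ℓ + 3) → Fin (ℓ + 3))

/-! ### Threshold matching: `∏_w g_w² ≤ ∏_e g_{u(e)} g_{v(e)}` -/

/-- **Domination of the gap products.**  For a convergent bijective seating, a point `t` of the open simplex, and
choices `u(e)` of a largest gap in the span of each finite `σδ⁰`-edge `e` and `v(e) ≠ u(e)` of a largest gap among
the remaining ones: `(∏_w g_w)² ≤ ∏_e g_{u(e)} · g_{v(e)}`.  (Hall matching of thresholds; the marriage condition is
the two-cover count `two_mul_card_le_meetCount_add_meetTwiceCount`.) -/
theorem prod_gapN_sq_le_prod_top_two (hσ : Function.Bijective σ) (hc : Convergent σ) (hℓ : 1 ≤ ℓ)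
    {t : Fin ℓ → ℝ} (ht : t ∈ openSimplex ℓ) (u v : SEdge σ → Fin (ℓ + 1))
    (humax : ∀ i, ∀ w ∈ (cellEdges σ hσ.1).span (Sum.inr i), gapN t w ≤ gapN t (u i))
    (hvmax : ∀ i, ∀ w ∈ (cellEdges σ hσ.1).span (Sum.inr i), w ≠ u i → gapN t w ≤ gapN t (v i)) :
    (∏ w : Fin (ℓ + 1), gapN t w) ^ 2 ≤ ∏ i : SEdge σ, (gapN t (u i) * gapN t (v i)) := by
  classical
  have hpos := (mem_openSimplex_iff_gapN t).1 ht
  set E := cellEdges σ hσ.1 with hE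
  -- values of the right-hand factors, indexed by `SEdge σ × Bool` (`false ↦ u`, `true ↦ v`)
  set val : SEdge σ × Bool → ℝ := fun β => cond β.2 (gapN t (v β.1)) (gapN t (u β.1)) with hval
  -- admissible targets of a left-hand factor `(w, b)`: right-hand factors at least as large
  set T : Fin (ℓ + 1) × Bool → Finset (SEdge σ × Bool) := fun a => univ.filter fun β => gapN t a.1 ≤ val β
    with hT
  -- Hall's condition
  have hall : ∀ s : Finset (Fin (ℓ + 1) × Bool), s.card ≤ (s.biUnion T).card := by
    intro s
    rcases s.eq_empty_or_nonempty with rfl | hs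
    · simp
    obtain ⟨a0, ha0, hmin⟩ := s.exists_min_image (fun a => gapN t a.1) hs
    set θ := gapN t a0.1 with hθ
    set Z : Finset (Fin (ℓ + 1)) := univ.filter fun w => θ ≤ gapN t w with hZ
    have hZne : Z.Nonempty := ⟨a0.1, by simp [hZ, hθ]⟩
    -- `s ⊆ Z × Bool`
    have hsZ : s.card ≤ 2 * Z.card := by
      have hsub : s ⊆ Z ×ˢ (univ : Finset Bool) := by
        intro a ha
        rw [Finset.mem_product]
        exact ⟨by simp only [hZ, Finset.mem_filter, Finset.mem_univ, true_and]; exact hmin a ha, Finset.mem_univ _⟩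
      have := Finset.card_le_card hsub
      rw [Finset.card_product, Finset.card_univ, Fintype.card_bool] at this
      omega
    -- `T a0 ⊇ {(e,false) : span e meets Z} ⊔ {(e,true) : span e meets Z twice}`
    have hcount : meetCount σ hσ Z + meetTwiceCount σ hσ Z ≤ (T a0).card := by
      let ι₁ : SEdge σ ↪ SEdge σ × Bool := ⟨fun i => (i, false), fun i j h => (Prod.ext_iff.1 h).1⟩
      let ι₂ : SEdge σ ↪ SEdge σ × Bool := ⟨fun i => (i, true), fun i j h => (Prod.ext_iff.1 h).1⟩
      set A := (univ.filter fun i : SEdge σ => (E.span (Sum.inr i) ∩ Z).Nonempty).map ι₁ with hA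
      set B := (univ.filter fun i : SEdge σ => 2 ≤ (E.span (Sum.inr i) ∩ Z).card).map ι₂ with hB
      have hAB : Disjoint A B := by
        rw [Finset.disjoint_left]
        intro β hβA hβB
        obtain ⟨i, -, rfl⟩ := Finset.mem_map.1 hβA
        obtain ⟨j, -, hj⟩ := Finset.mem_map.1 hβB
        have := (Prod.ext_iff.1 hj).2
        simp [ι₁, ι₂] at this
      have hcardAB : (A ∪ B).card = meetCount σ hσ Z + meetTwiceCount σ hσ Z := by
        rw [Finset.card_union_of_disjoint hAB, hA, hB, Finset.card_map, Finset.card_map]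
        rfl
      rw [← hcardAB]
      refine Finset.card_le_card fun β hβ => ?_
      rw [Finset.mem_union] at hβ
      simp only [hT, Finset.mem_filter, Finset.mem_univ, true_and]
      rcases hβ with hβ | hβ
      · obtain ⟨i, hi, rfl⟩ := Finset.mem_map.1 hβ
        simp only [Finset.mem_filter, Finset.mem_univ, true_and] at hi
        obtain ⟨w, hw⟩ := hi
        rw [Finset.mem_inter] at hw
        have h1 : θ ≤ gapN t w := by simpa [hZ] using hw.2
        exact h1.trans (humax i w hw.1)
      · obtain ⟨i, hi, rfl⟩ := Finset.mem_map.1 hβ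
        simp only [Finset.mem_filter, Finset.mem_univ, true_and] at hi
        obtain ⟨w, hw, hwu⟩ := Finset.exists_mem_ne hi (u i)
        rw [Finset.mem_inter] at hw
        have h1 : θ ≤ gapN t w := by simpa [hZ] using hw.2
        exact h1.trans (hvmax i w hw.1 hwu)
    have hkey := two_mul_card_le_meetCount_add_meetTwiceCount σ hσ hc hℓ hZne
    calc s.card ≤ 2 * Z.card := hsZ
      _ ≤ (T a0).card := hkey.trans hcount
      _ ≤ (s.biUnion T).card := Finset.card_le_card (Finset.subset_biUnion_of_mem T ha0)
  obtain ⟨f, hf, hfT⟩ := (Finset.all_card_le_biUnion_card_iff_exists_injective T).1 hall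
  have hbij : Function.Bijective f := by
    rw [Fintype.bijective_iff_injective_and_card]
    exact ⟨hf, by rw [Fintype.card_prod, Fintype.card_prod, card_sEdge σ hσ, Fintype.card_fin]⟩
  have hle : ∀ a, gapN t a.1 ≤ val (f a) := fun a => by
    have := hfT a
    simp only [hT, Finset.mem_filter, Finset.mem_univ, true_and] at this
    exact this
  -- compare the products through the bijection `f`
  have hL : (∏ w : Fin (ℓ + 1), gapN t w) ^ 2 = ∏ a : Fin (ℓ + 1) × Bool, gapN t a.1 := by
    rw [Fintype.prod_prod_type, ← Finset.prod_pow]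
    refine Finset.prod_congr rfl fun w _ => ?_
    rw [Fintype.prod_bool, sq]
  have hR : ∏ i : SEdge σ, (gapN t (u i) * gapN t (v i)) = ∏ β : SEdge σ × Bool, val β := by
    rw [Fintype.prod_prod_type]
    refine Finset.prod_congr rfl fun i _ => ?_
    rw [Fintype.prod_bool]
    simp only [hval, cond_true, cond_false]
    ring
  rw [hL, hR, ← Equiv.prod_comp (Equiv.ofBijective f hbij) val]
  exact Finset.prod_le_prod (fun a _ => (hpos _).le) fun a _ => hle a

/-! ### The universal bound -/

/-- **`f_σ ≤ 2^{−(ℓ+1)}` on the open simplex, for EVERY convergent bijective seating on `n = ℓ + 3 ≥ 4` points.**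
[Brown2016, §1.5 objects; structural] -/
theorem fSigma_le_half_pow (hσ : Function.Bijective σ) (hc : Convergent σ) (hℓ : 1 ≤ ℓ) {t : Fin ℓ → ℝ}
    (ht : t ∈ openSimplex ℓ) : fSigma σ t ≤ (1 / 2) ^ (ℓ + 1) := by
  classical
  have hpos := (mem_openSimplex_iff_gapN t).1 ht
  set E := cellEdges σ hσ.1 with hE
  have hlen : ∀ i : SEdge σ, 0 < E.len t (Sum.inr i) := fun i => E.len_pos ht _
  -- a largest gap `u i` of each span, and a largest `v i` among the others
  have hu' : ∀ i : SEdge σ, ∃ x ∈ E.span (Sum.inr i), ∀ w ∈ E.span (Sum.inr i), gapN t w ≤ gapN t x :=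
    fun i => Finset.exists_max_image _ _ (E.span_nonempty _)
  choose u hu humax using hu'
  have hv' : ∀ i : SEdge σ, ∃ x ∈ (E.span (Sum.inr i)).erase (u i),
      ∀ w ∈ (E.span (Sum.inr i)).erase (u i), gapN t w ≤ gapN t x := fun i =>
    Finset.exists_max_image _ _ (by
      rw [← Finset.card_pos, Finset.card_erase_of_mem (hu i)]
      have := two_le_card_span σ hσ hc hℓ i
      rw [← hE] at this
      omega)
  choose v hv hvmax using hv'
  have hvu : ∀ i, v i ≠ u i := fun i => (Finset.mem_erase.1 (hv i)).1
  have hvs : ∀ i, v i ∈ E.span (Sum.inr i) := fun i => (Finset.mem_erase.1 (hv i)).2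
  have hvmax' : ∀ i, ∀ w ∈ E.span (Sum.inr i), w ≠ u i → gapN t w ≤ gapN t (v i) :=
    fun i w hw hne => hvmax i w (Finset.mem_erase.2 ⟨hne, hw⟩)
  have hL : 0 < ∏ i : SEdge σ, E.len t (Sum.inr i) := Finset.prod_pos fun i _ => hlen i
  unfold fSigma
  rw [prod_ef_succ_eq_prod_gapN, formDen_eq_prod_len σ hσ ht, div_le_iff₀ hL]
  -- compare squares
  have hPnn : 0 ≤ ∏ w : Fin (ℓ + 1), gapN t w := Finset.prod_nonneg fun w _ => (hpos w).le
  have hRnn : 0 ≤ (1 / 2 : ℝ) ^ (ℓ + 1) * ∏ i : SEdge σ, E.len t (Sum.inr i) := by positivity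
  rw [← pow_le_pow_iff_left₀ hPnn hRnn two_ne_zero]
  have hcard : (Finset.univ : Finset (SEdge σ)).card = ℓ + 1 := by rw [Finset.card_univ, card_sEdge σ hσ]
  have hsq' : ((1 / 2 : ℝ) ^ (ℓ + 1) * ∏ i : SEdge σ, E.len t (Sum.inr i)) ^ 2 =
      ∏ i : SEdge σ, (E.len t (Sum.inr i) ^ 2 / 4) := by
    -- adapted from `fSigma_le_half_pow_of_two_sdr` (Families/BasicGrowthTwoFactor.lean)
    rw [mul_pow, ← pow_mul, mul_comm (ℓ + 1) 2, pow_mul, ← Finset.prod_pow, Finset.prod_div_distrib,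
      Finset.prod_const, hcard]
    have h14 : ((1 / 2 : ℝ) ^ 2) = 1 / 4 := by norm_num
    rw [h14, one_div_pow, one_div_mul_eq_div]
  rw [hsq']
  refine (prod_gapN_sq_le_prod_top_two σ hσ hc hℓ ht u v humax hvmax').trans
    (Finset.prod_le_prod (fun i _ => (mul_pos (hpos _) (hpos _)).le) fun i _ => ?_)
  -- `4 g_u g_v ≤ (g_u + g_v)² ≤ len²`
  have hsum : gapN t (u i) + gapN t (v i) ≤ E.len t (Sum.inr i) := by
    rw [E.len_eq_sum_gap]
    have hpair : ({u i, v i} : Finset (Fin (ℓ + 1))) ⊆ E.span (Sum.inr i) := by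
      intro x hx
      rw [Finset.mem_insert, Finset.mem_singleton] at hx
      rcases hx with rfl | rfl
      · exact hu i
      · exact hvs i
    have h2 := Finset.sum_le_sum_of_subset_of_nonneg hpair fun x _ _ => (hpos x).le
    rwa [Finset.sum_pair (hvu i).symm] at h2
  have hg1 := hpos (u i)
  have hg2 := hpos (v i)
  nlinarith [sq_nonneg (gapN t (u i) - gapN t (v i)), mul_self_le_mul_self (by linarith) hsum]

/-- **The universal growth bound: `M_σ ≤ 2^{−(ℓ+1)} = 2^{−(n−2)}`** for every convergent bijective seating on
`n = ℓ + 3 ≥ 4` points. -/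
theorem fSup_le_half_pow (hσ : Function.Bijective σ) (hc : Convergent σ) (hℓ : 1 ≤ ℓ) :
    fSup σ ≤ (1 / 2) ^ (ℓ + 1) :=
  fSup_le_of_forall_le σ fun _ ht => fSigma_le_half_pow σ hσ hc hℓ ht

/-- **`I_σ(N) ≤ 2^{−(ℓ+1)N} · I_σ(0)`** for every convergent bijective seating on `n = ℓ + 3 ≥ 4` points and every
`N ∈ ℕ`: the basic cellular integrals of EVERY convergent configuration decay at least at the rate `2^{−(n−2)}` per
step. [Brown2016, §1.5 objects; structural] -/
theorem integral_basic_le_half_pow_pow (hσ : Function.Bijective σ) (hc : Convergent σ) (hℓ : 1 ≤ ℓ) (N : ℕ) :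
    integral σ (fun _ => (N : ℤ)) (fun _ => (N : ℤ)) ≤
      ((1 / 2) ^ (ℓ + 1)) ^ N * integral σ (fun _ => (0 : ℤ)) (fun _ => (0 : ℤ)) :=
  (integral_basic_le_fSup_pow σ hσ N).trans (mul_le_mul_of_nonneg_right
    (pow_le_pow_left₀ (fSup_pos σ hσ).le (fSup_le_half_pow σ hσ hc hℓ) N) (integral_nonneg hσ.1 _ _))

/-- Pointwise form: `f_σ^N ω_σ ≤ 2^{−(ℓ+1)N} ω_σ` on the open simplex. -/
theorem basic_le_half_pow_pow_mul (hσ : Function.Bijective σ) (hc : Convergent σ) (hℓ : 1 ≤ ℓ) (N : ℕ)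
    {t : Fin ℓ → ℝ} (ht : t ∈ openSimplex ℓ) : basic σ (N : ℤ) t ≤ ((1 / 2) ^ (ℓ + 1)) ^ N * basic σ 0 t := by
  rw [basic_natCast_eq]
  exact mul_le_mul_of_nonneg_right
    (pow_le_pow_left₀ (fSigma_pos σ hσ.1 ht).le (fSigma_le_half_pow σ hσ hc hℓ ht) N) (integrand_pos hσ.1 _ _ ht).le

/-- The rate per step in closed form: `(1/2)^{ℓ+1} = 2^{−(n−2)}` with `n = ℓ + 3`, e.g. `1/64` for `n = 8` (all
seventeen `N = 8` configurations, in particular `₈π₈^∨` of [BrownZudilin2022]) and `1/256` for `n = 10`. -/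
theorem limsup_rate_le (hσ : Function.Bijective σ) (hc : Convergent σ) (hℓ : 1 ≤ ℓ) :
    Tendsto (fun N : ℕ => (integral σ (fun _ => (N : ℤ)) (fun _ => (N : ℤ))) ^ (1 / (N : ℝ))) atTop
      (𝓝 (fSup σ)) ∧ fSup σ ≤ (1 / 2) ^ (ℓ + 1) :=
  ⟨tendsto_integral_basic_root σ hσ hc, fSup_le_half_pow σ hσ hc hℓ⟩

end Summit.KontsevichZagierPeriods.Zeta5Search.Families.Cellular
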